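import Mathlib
import Summits.KontsevichZagierPeriods.Zeta5Search.AtlasRayRow2
import Summits.KontsevichZagierPeriods.Zeta5Search.RayAtlasCellsRows
import Summits.KontsevichZagierPeriods.Zeta5Search.Atlas.Row2CellEP4
import HarnessLib

/-!
# ζ(5) search — atlas machine, cell `Row2CellE` of the ray `bFam 12 n` (part 2/2): `RayAtlas.Row2CellE` (HONEST FRAMING: systematic search; no irrationality claim unless certified)

Cell `pub-zeta5`, P1 prover seat generation 8 (gap-filling rebuild of generation 7's machine: the parts of this cell landed by
generation 7 are reused by name, the missing ones regenerated).  MACHINE-GENERATED by `code/gen/leangen.py` from the exact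
scale-free class analysis `code/gen/raycell.py` (all odd `p` and all `n ≤ 150` in the cell sampled, 937 instances; every
statement below is then PROVED, the atlas by `omega`).  Cell: `11 * n < 2 * p`, `3 * p ≤ 17 * n`; level `m = -11`; class lengths `[7, 8]`;
bracket signatures per length `{7: 4, 8: 15}`; kind `origin-formal`
(level-`m` types: (1, 1, -1, -6, -6, -2, 1, 1) (L=7); (1, 1, -2, -6, -6, -1, 1, 1) (L=7)); bound `-18 = 3 + 2m + 1` from
`CellKit.origin_bound`.  Valuations of rationals; nothing about irrationality.
-/

open Finset

namespace Summit.KontsevichZagierPeriods.Zeta5Search.Atlas.Row2CellE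

open Summit.KontsevichZagierPeriods.Zeta5Search.ClusterValuation (netExp classSet CentreIn classExp conjClass bRec)
open Summit.KontsevichZagierPeriods.Zeta5Search.CasoratianValuation (InPolytope shift casoratian)
open Summit.KontsevichZagierPeriods.Zeta5Search.CellKit
open Summit.KontsevichZagierPeriods.Zeta5Search.CellA (wHat vHat)
open Summit.KontsevichZagierPeriods.Zeta5Search.CellAtlas (bFam)
open Summit.KontsevichZagierPeriods.Zeta5Search.AtlasRayRow2


variable {p : ℕ} [hp : Fact p.Prime]

/-- **`RayAtlas.Row2CellE` IS A THEOREM** (`v_p(Cas₇) ≥ -18` on the cell; `origin-formal`, `m = -11`). -/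
theorem holds : RayAtlas.Row2CellE := by
  intro n p hn hprime hw h1 h2 hne
  haveI : Fact p.Prime := ⟨hprime⟩
  have hp5 : 5 ≤ p := by omega
  have hp2 : p % 2 = 1 := Nat.odd_iff.1 (hprime.odd_of_ne_two (by omega))
  have hray : bFam 12 n = bLin (12 * n) (8 * n) n := by
    rw [bFam_eq_bLin (by norm_num)]
  rw [hray] at hne ⊢
  have hb : InPolytope (bLin (12 * n) (8 * n) n) := inPolytope_bLin (by omega)
  have hb' : InPolytope (shift (bLin (12 * n) (8 * n) n) 7) := inPolytope_shift_bLin (by omega) (by omega)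
  have hwin : (bLin (12 * n) (8 * n) n 0 + 2 : ℤ) < (p : ℤ) ^ 2 := by
    have hw' : ((44 * n + 2 : ℕ) : ℤ) < ((p * p : ℕ) : ℤ) := by exact_mod_cast hw
    rw [b0_int]; push_cast at hw' ⊢; nlinarith [hw']
  have hpN : p ≤ ((bLin (12 * n) (8 * n) n) 0).toNat := by rw [b0_toNat]; omega
  have key := origin_bound (bLin (12 * n) (8 * n) n) hb (j := 7) (by norm_num) (by norm_num) hb' hp5 hwin hpN (m := -11) (by norm_num)
    (fun x hx => exp_ge h1 h2 hp2 hx) (fun x hx hE => cen h1 h2 hp2 hx hE) (hcol h1 h2 hp2) hne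
  linarith

end Summit.KontsevichZagierPeriods.Zeta5Search.Atlas.Row2CellE
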